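import Summits.Ventures.HodgeRepro2.T5SU11GroundStateTransform
import Summits.Ventures.HodgeRepro2.T5SU11ResolventBound

/-!
# The Hardy inequality `∫_0^∞ sinh 2t (G_λ f)′² ≥ ∫_0^∞ sinh 2t (G_λ f)²` and the spectral gap of the resolvent

Letting `ε → 0⁺` and `R → ∞` in row 477's `∫_ε^R sinh 2t u² ≤ ∫_ε^R sinh 2t (u′)² − (H(R) − H(ε))` for `u = G_λ f`
(`λ > 1`, `f` continuous and supported in `[a, b]`; `H(ε) → 0`, `H(R) → 0`, the integrability of rows 474–475):

  **`∫_0^∞ sinh 2t (G_λ f)² ≤ ∫_0^∞ sinh 2t (G_λ f)′²`**  (`hardy_inequality`),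

the Hardy (ground-state) inequality `‖u′‖² ≥ ‖u‖²` in `L²(sinh 2t dt)` — the Dirichlet form of the radial Laplacian
`L = ∂² + 2 coth 2t ∂` is bounded below by `ρ² = 1` on the range of the resolvent. With the energy identity (row 475),
`−⟨G_λ f, f⟩ = ‖u′‖² + λ(λ−2)‖u‖² ≥ (1 + λ(λ−2))‖u‖² = (λ−1)²‖u‖²`:

* **`⟨G_λ f, f⟩ ≤ −(λ−1)² ‖G_λ f‖²`** for every `λ > 1` (`inner_sphGreen_le`), so **the quadratic form of the
  resolvent is non-positive for EVERY `λ > 1`** (`inner_sphGreen_nonpos_of_one_lt`; row 475 had `λ ≥ 2`);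
* **`‖G_λ f‖² ≤ ‖f‖² / (λ−1)⁴`** for every `λ > 1` (`integral_sinh_mul_sphGreen_sq_le_of_one_lt`), i.e.
  `‖(L − λ(λ−2))⁻¹‖ ≤ 1/(λ−1)² = 1/dist(λ(λ−2), (−∞, −1])` — the resolvent bound of a self-adjoint operator with
  spectrum in `(−∞, −ρ²]`, with the exact distance to the bottom of the spectrum `−ρ² = −1`.

Nothing is claimed about (N).

Blind lane: Mathlib + the HodgeRepro2 prefix only; no sorry; axioms ⊆ {propext, Classical.choice,
Quot.sound}.
-/

namespace Summit.Ventures.HodgeRepro2.T5SU11HardyInequality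

open Filter Topology MeasureTheory intervalIntegral
open Set (Ioi Ioc Icc uIcc)
open T5SU11Cartan T5SU11SphericalFunction T5SU11SphericalGreen T5SU11ResolventTransform
  T5SU11ResolventEnergyPieces T5SU11ResolventEnergy T5SU11GroundStateTransform T5SU11ResolventBound

section measure

variable [MeasurableSpace Circle] [BorelSpace Circle]

variable {lam a b : ℝ} {f : ℝ → ℝ} (hlam : 1 < lam) (hf : ContinuousOn f (Ioi 0))
  (ha : 0 < a) (hab : a ≤ b) (hfa : ∀ s, s ≤ a → f s = 0) (hfb : ∀ s, b ≤ s → f s = 0)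

include hlam hf ha hab hfa in
/-- **The Hardy inequality on `[0, R]`**, `b ≤ R`: `∫_0^R sinh 2t u² ≤ ∫_0^R sinh 2t (u′)² − H(R)`. -/
theorem hardy_ineq_finite {R : ℝ} (hbR : b ≤ R) :
    ∫ t in (0 : ℝ)..R, Real.sinh (2 * t) * sphGreen lam f a b t ^ 2 ≤ (∫ t in (0 : ℝ)..R, Real.sinh (2 * t) * sphGreen' lam f a b t ^ 2) - hardyBracket (sphGreen lam f a b) R := by
  have hb : 0 < b := lt_of_lt_of_le ha hab
  have hR : 0 < R := lt_of_lt_of_le hb hbR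
  have hAint : ∀ c, 0 ≤ c → IntervalIntegrable (fun t => Real.sinh (2 * t) * sphGreen' lam f a b t ^ 2) volume 0 c := fun c hc =>
    (intervalIntegrable_iff_integrableOn_Ioc_of_le hc).mpr (integrableOn_sinh_mul_sphGreen'_sq_Ioc hlam hf ha hab hfa c)
  have hBint : ∀ c, 0 ≤ c → IntervalIntegrable (fun t => Real.sinh (2 * t) * sphGreen lam f a b t ^ 2) volume 0 c := fun c hc =>
    (intervalIntegrable_iff_integrableOn_Ioc_of_le hc).mpr (integrableOn_sinh_mul_sphGreen_sq_Ioc hlam hf ha hab hfa c)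
  have hcu' : ContinuousOn (sphGreen' lam f a b) (Ioi 0) :=
    fun t ht => (hasDerivAt_sphGreen' hlam hf ha hab ht).continuousAt.continuousWithinAt
  -- the two sides as `ε → 0⁺`
  have hl : Tendsto (fun ε => ∫ t in ε..R, Real.sinh (2 * t) * sphGreen lam f a b t ^ 2) (𝓝[>] 0) (𝓝 ((∫ t in (0 : ℝ)..R, Real.sinh (2 * t) * sphGreen lam f a b t ^ 2) - 0)) := by
    refine (tendsto_const_nhds.sub (tendsto_integral_sinh_mul_sphGreen_sq_nhdsGT_zero hlam hf ha hab hfa)).congr' ?_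
    filter_upwards [Ioo_mem_nhdsGT ha] with ε hε
    exact integral_interval_sub_left (hBint R hR.le) (hBint ε hε.1.le)
  have hr : Tendsto (fun ε => (∫ t in ε..R, Real.sinh (2 * t) * sphGreen' lam f a b t ^ 2) - (hardyBracket (sphGreen lam f a b) R - hardyBracket (sphGreen lam f a b) ε)) (𝓝[>] 0)
      (𝓝 (((∫ t in (0 : ℝ)..R, Real.sinh (2 * t) * sphGreen' lam f a b t ^ 2) - 0) - (hardyBracket (sphGreen lam f a b) R - 0))) := by
    refine ((tendsto_const_nhds.sub (tendsto_integral_sinh_mul_sphGreen'_sq_nhdsGT_zero hlam hf ha hab hfa)).sub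
      (tendsto_const_nhds.sub (tendsto_hardyBracket_left hlam hf ha hab hfa))).congr' ?_
    filter_upwards [Ioo_mem_nhdsGT ha] with ε hε
    rw [integral_interval_sub_left (hAint R hR.le) (hAint ε hε.1.le)]
  have := le_of_tendsto_of_tendsto hl hr ?_
  · simpa only [sub_zero] using this
  · filter_upwards [Ioo_mem_nhdsGT ha] with ε hε
    exact hardy_ineq_interval (fun t ht => hasDerivAt_sphGreen hlam hf ha hab ht) hcu' hε.1
      (le_trans hε.2.le (le_trans hab hbR))

include hlam hf ha hab hfa hfb in
/-- **The Hardy inequality**: `∫_0^∞ sinh 2t (G_λ f)² ≤ ∫_0^∞ sinh 2t (G_λ f)′²` for every `λ > 1`. -/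
theorem hardy_inequality :
    ∫ t in Ioi 0, Real.sinh (2 * t) * sphGreen lam f a b t ^ 2 ≤ ∫ t in Ioi 0, Real.sinh (2 * t) * sphGreen' lam f a b t ^ 2 := by
  have hl := intervalIntegral_tendsto_integral_Ioi 0 (integrableOn_sinh_mul_sphGreen_sq hlam hf ha hab hfa hfb)
    (tendsto_id (x := atTop))
  have hr := (intervalIntegral_tendsto_integral_Ioi 0 (integrableOn_sinh_mul_sphGreen'_sq hlam hf ha hab hfa hfb)
    (tendsto_id (x := atTop))).sub (tendsto_hardyBracket_right hlam hf ha hab hfb)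
  have := le_of_tendsto_of_tendsto hl hr ?_
  · simpa only [sub_zero] using this
  · filter_upwards [eventually_ge_atTop b] with R hR
    simpa only [id] using hardy_ineq_finite hlam hf ha hab hfa hR

/-! ### The spectral gap -/

include hlam hf ha hab hfa hfb in
/-- **`⟨G_λ f, f⟩ ≤ −(λ−1)² ‖G_λ f‖²`** for every `λ > 1`. -/
theorem inner_sphGreen_le :
    ∫ t in a..b, f t * sphGreen lam f a b t * Real.sinh (2 * t)
      ≤ -((lam - 1) ^ 2 * ∫ t in Ioi 0, Real.sinh (2 * t) * sphGreen lam f a b t ^ 2) := by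
  have hE := energy_identity hlam hf ha hab hfa hfb
  have hH := hardy_inequality hlam hf ha hab hfa hfb
  have heq : ∫ t in a..b, f t * sphGreen lam f a b t * Real.sinh (2 * t) = ∫ t in a..b, Real.sinh (2 * t) * (f t * sphGreen lam f a b t) :=
    integral_congr (fun t _ => by ring)
  have hsq : (lam - 1) ^ 2 = 1 + lam * (lam - 2) := by ring
  rw [heq, hsq]
  linarith

include hlam hf ha hab hfa hfb in
/-- **The quadratic form of the resolvent is non-positive for every `λ > 1`.** -/
theorem inner_sphGreen_nonpos_of_one_lt :
    ∫ t in a..b, f t * sphGreen lam f a b t * Real.sinh (2 * t) ≤ 0 := by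
  have h := inner_sphGreen_le hlam hf ha hab hfa hfb
  have hB : 0 ≤ ∫ t in Ioi 0, Real.sinh (2 * t) * sphGreen lam f a b t ^ 2 :=
    setIntegral_nonneg measurableSet_Ioi (fun t ht =>
      mul_nonneg (Real.sinh_nonneg_iff.mpr (by linarith [Set.mem_Ioi.mp ht])) (sq_nonneg _))
  nlinarith [mul_nonneg (sq_nonneg (lam - 1)) hB]

include hlam hf ha hab hfa hfb in
/-- **The sharp resolvent bound**: `‖G_λ f‖² ≤ ‖f‖² / (λ−1)⁴` in `L²(sinh 2t dt)` for every `λ > 1`. -/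
theorem integral_sinh_mul_sphGreen_sq_le_of_one_lt :
    ∫ t in Ioi 0, Real.sinh (2 * t) * sphGreen lam f a b t ^ 2 ≤ (∫ t in a..b, Real.sinh (2 * t) * f t ^ 2) / (lam - 1) ^ 4 := by
  set ν := (lam - 1) ^ 2 with hν
  have hνpos : 0 < ν := by rw [hν]; exact pow_pos (by linarith) 2
  have hle := inner_sphGreen_le hlam hf ha hab hfa hfb
  have heq : ∫ t in a..b, f t * sphGreen lam f a b t * Real.sinh (2 * t) = ∫ t in a..b, Real.sinh (2 * t) * (f t * sphGreen lam f a b t) :=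
    integral_congr (fun t _ => by ring)
  rw [heq] at hle
  -- the pointwise inequality integrated over `[a, b]`
  have hcu : ContinuousOn (sphGreen lam f a b) (Ioi 0) :=
    fun t ht => (hasDerivAt_sphGreen hlam hf ha hab ht).continuousAt.continuousWithinAt
  have hcs : ContinuousOn (fun t => Real.sinh (2 * t)) (Ioi 0) :=
    (Real.continuous_sinh.comp (continuous_const.mul continuous_id)).continuousOn
  have hsub : uIcc a b ⊆ Ioi 0 := T5SU11RadialGreen.uIcc_subset_Ioi ha (lt_of_lt_of_le ha hab)
  have hCi : IntervalIntegrable (fun t => Real.sinh (2 * t) * (f t * sphGreen lam f a b t)) volume a b :=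
    ((hcs.mul (hf.mul hcu)).mono hsub).intervalIntegrable
  have hBi : IntervalIntegrable (fun t => Real.sinh (2 * t) * sphGreen lam f a b t ^ 2) volume a b :=
    ((continuousOn_sinh_mul_sphGreen_sq hlam hf ha hab).mono hsub).intervalIntegrable
  have hFi : IntervalIntegrable (fun t => Real.sinh (2 * t) * f t ^ 2) volume a b :=
    ((hcs.mul (hf.pow 2)).mono hsub).intervalIntegrable
  have hpt : ∀ t ∈ Icc a b, -(2 * ν) * (Real.sinh (2 * t) * (f t * sphGreen lam f a b t)) ≤ ν ^ 2 * (Real.sinh (2 * t) * sphGreen lam f a b t ^ 2) + Real.sinh (2 * t) * f t ^ 2 := by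
    intro t ht
    have hs : 0 ≤ Real.sinh (2 * t) := Real.sinh_nonneg_iff.mpr (by linarith [ht.1])
    have := mul_le_mul_of_nonneg_left (neg_two_mul_mul_le ν (f t) (sphGreen lam f a b t)) hs
    linarith [this]
  have hC := integral_mono_on hab (hCi.const_mul _) ((hBi.const_mul _).add hFi) hpt
  rw [intervalIntegral.integral_const_mul, integral_add (hBi.const_mul _) hFi,
    intervalIntegral.integral_const_mul] at hC
  have hBsub := intervalIntegral_sinh_mul_sphGreen_sq_le hlam hf ha hab hfa hfb
  have h3 := mul_le_mul_of_nonneg_left hBsub (sq_nonneg ν)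
  have h1 : ν * ∫ t in Ioi 0, Real.sinh (2 * t) * sphGreen lam f a b t ^ 2 ≤ -∫ t in a..b, Real.sinh (2 * t) * (f t * sphGreen lam f a b t) := by linarith
  have h4 := mul_le_mul_of_nonneg_left h1 (by linarith : (0 : ℝ) ≤ 2 * ν)
  have hν4 : (lam - 1) ^ 4 = ν ^ 2 := by rw [hν]; ring
  rw [hν4, le_div_iff₀ (pow_pos hνpos 2)]
  nlinarith [h3, h4, hC]

include hlam hf ha hab hfa hfb in
/-- **The sharp resolvent bound with both norms over `(0, ∞)`**: `‖G_λ f‖² ≤ ‖f‖²/(λ−1)⁴`. -/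
theorem integral_sinh_mul_sphGreen_sq_le_of_one_lt_Ioi :
    ∫ t in Ioi 0, Real.sinh (2 * t) * sphGreen lam f a b t ^ 2 ≤ (∫ t in Ioi 0, Real.sinh (2 * t) * f t ^ 2) / (lam - 1) ^ 4 := by
  rw [integral_Ioi_sinh_mul_sq_eq ha hab hfa hfb]
  exact integral_sinh_mul_sphGreen_sq_le_of_one_lt hlam hf ha hab hfa hfb

end measure

end Summit.Ventures.HodgeRepro2.T5SU11HardyInequality
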